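import Literature.AlgebraicGeometry.Frobenioids.EquivalencePreStepsFSMFF2008Assembly
import Literature.AlgebraicGeometry.Frobenioids.Thm42iiAndiiiGeneralWeak
import HarnessLib

/-!
# Frobenioids I, Theorem 4.2 (i)(ii)(iii) AS TYPED for every pair of Frobenioids with WEAKLY
# perf-factorial divisor monoids — the "modulo pre-steps" binders discharged from the Setting itself

Mochizuki, *The geometry of Frobenioids I: the general theory*, Kyushu J. Math. **62** (2008) 293–400,
Thm. 4.2, statement pp. 77–78 (proof pp. 78–81), Thm. 3.4 (ii) p. 62
[cite: MochizukiFrdI2008, Thm. 4.2 p.77].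

PROOF-ONLY file (cell abc-iut, layer L1, node `FrdI:Thm4.2`; seat abc-iut-L1-t11; no definitions, no landed
declaration touched).  The weak-hypothesis twin of this seat's `Thm42AsTypedAllFrobenioids.lean`.

Seat abc-iut-L1-t12's chain `Thm42PrimaryStepsGeneralWeak` → `PrimesEquivWeak` → `Thm42DivIdentityWeak` →
`Thm42OfPreStepsGeneralWeak` → `Thm42iiWeak` / `Thm42iiiWeak` → `Thm42iiAndiiiGeneralWeak` (request of seat
abc-iut-L2-d2, for the [EtTh] §3 tempered data whose divisor monoids are only WEAKLY perf-factorial, cf.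
`PerfFactorialWeak.lean`) proves the typed [FrdI] Thm. 4.2 (i), (ii), (iii) at `ofFunctor` with
`Objectwise IsPerfFactorial` replaced by `Objectwise IsPerfFactorialWeak`, MODULO ONLY the two binders
"`Ψ`, `Ψ⁻¹` preserve pre-steps" (`FrdI.T42.thm42i_ofFunctor_of_preservesPreSteps_weak`, `…ii…`, `…iii…`,
`thm42ii_iii_ofFunctor_of_preservesPreSteps_weak`), and instantiates them over bases of FSMFF-type in the
author's revised (2024) sense.  Exactly as in the perf-factorial case, those two binders are theorems of the typed
`Thm42Setting` ITSELF: its standard type (Def. 3.1 (i)(d)) carries the PRINTED (2008) FSMFF condition on both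
bases, and [FrdI] Thm. 3.4 (ii) AS PRINTED (`FrdI.isPreStep_map_of_quasiIsotropic_of_isOfFSMFFType`,
`EquivalencePreStepsFSMFF2008Assembly.lean`, over seat abc-iut-L1-t13's core `EquivalencePreStepsFSMFF2008.lean`)
needs no hypothesis on the divisor monoids.  Hence:

* `FrdI.T42.isPreStep_map_of_thm42Setting` / `…inverse_map…` — the pre-step binders themselves as theorems of the
  typed `Thm42Setting` (no hypothesis on `Φ_i`), and `FrdI.T42.isPrimaryPreStep_map_weak` / `…inverse_map_weak` —
  Thm. 4.2 (i)'s primary-steps clause for WEAKLY perf-factorial `Φ_i` with no pre-step / FSM-type / perfectness binder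
  (the binders `hprim`/`hprim'` of the cell's [EtTh] Cor. 3.8 (iii) weak discharge, seat abc-iut-L2-d2);
* `FrdI.T42.thm42i_ofFunctor_weak`, `FrdI.T42.thm42ii_ofFunctor_weak`, `FrdI.T42.thm42iii_ofFunctor_weak` — the
  typed `PreFrobenioidData.Thm42i` / `Thm42ii` / `Thm42iii` at `ofFunctor` for EVERY pair of Frobenioids
  `C_i → F_{Φ_i}` with `Φ_i` WEAKLY perf-factorial and every equivalence `Ψ` (for (iii): every prime bijection
  `e` compatible with `Ψ` as in the typed statement) — no pre-step binder, no base hypothesis, no 2024 revision,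
  no perfectness;
* `FrdI.T42.thm42ii_iii_ofFunctor_weak` — THE family of (ii) exists and (iii) holds for it, same generality.

The printed (perf-factorial) theorems `FrdI.T42.thm42i/ii/iii_ofFunctor` are recovered from these via
`IsPerfFactorial.weak` (recorded as `example`s in the cell's audit probe, not restated here).  Nothing of the
paper is restated or strengthened: `IsPerfFactorialWeak` is a named WEAKENING of Def. 2.4 (i) (d), so each theorem
below implies its printed counterpart's instance.  HONEST FRAMING: classical [FrdI] §3–§4 algebra; nothing here
bears on [IUTchIII] Cor. 3.12.
-/

namespace Literature.AlgebraicGeometry.Frobenioids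

open CategoryTheory Opposite

/-! ### [FrdI] Thm. 4.2 (i)(ii)(iii) AS TYPED, weakly perf-factorial divisor monoids, no pre-step binder -/

namespace FrdI.T42

section

universe w v v' u u'

variable {D₁ : Type u} [Category.{v} D₁] {Φ₁ : D₁ᵒᵖ ⥤ CommMonCat.{w}} {C₁ : Type u'} [Category.{v'} C₁]
  {D₂ : Type u} [Category.{v} D₂] {Φ₂ : D₂ᵒᵖ ⥤ CommMonCat.{w}} {C₂ : Type u'} [Category.{v'} C₂]
  {F₁ : C₁ ⥤ ElemFrobenioid Φ₁} {F₂ : C₂ ⥤ ElemFrobenioid Φ₂} (Ψ : C₁ ≌ C₂)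

/-- **[FrdI] Thm. 3.4 (ii) under the typed Thm. 4.2 setting**: for Frobenioids `C_i → F_{Φ_i}` in a `Thm42Setting`
(standard type on both sides; no hypothesis on the divisor monoids), `Ψ` maps pre-steps to pre-steps — the binder
`hpre` of every "modulo pre-steps" closer of the cell's Thm. 4.2 chains, as a THEOREM of the setting: standard type (d)
is the printed (2008) FSMFF condition on `D₂`, and Thm. 3.4 (ii) as printed
(`FrdI.isPreStep_map_of_quasiIsotropic_of_isOfFSMFFType`) applies. [cite: MochizukiFrdI2008, Thm. 3.4 (ii) p.62] -/
theorem isPreStep_map_of_thm42Setting (hF₁ : PreFrobenioid.IsFrobenioid F₁) (hF₂ : PreFrobenioid.IsFrobenioid F₂)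
    (hT : PreFrobenioidData.Thm42Setting (PreFrobenioidData.ofFunctor Φ₁ F₁) (PreFrobenioidData.ofFunctor Φ₂ F₂))
    ⦃X Y : C₁⦄ (φ : X ⟶ Y) (hφ : PreFrobenioid.IsPreStep F₁ φ) :
    PreFrobenioid.IsPreStep F₂ (Ψ.functor.map φ) :=
  FrdI.isPreStep_map_of_quasiIsotropic_of_isOfFSMFFType hF₁ hF₂
    hT.standard.1.quasiIsotropic hT.standard.2.quasiIsotropic hT.standard.2.fsmff Ψ hφ

/-- … and `Ψ⁻¹` maps pre-steps to pre-steps (the binder `hpre'`; standard type (d) on `D₁`).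
[cite: MochizukiFrdI2008, Thm. 3.4 (ii) p.62] -/
theorem isPreStep_inverse_map_of_thm42Setting (hF₁ : PreFrobenioid.IsFrobenioid F₁)
    (hF₂ : PreFrobenioid.IsFrobenioid F₂)
    (hT : PreFrobenioidData.Thm42Setting (PreFrobenioidData.ofFunctor Φ₁ F₁) (PreFrobenioidData.ofFunctor Φ₂ F₂))
    ⦃X Y : C₂⦄ (φ : X ⟶ Y) (hφ : PreFrobenioid.IsPreStep F₂ φ) :
    PreFrobenioid.IsPreStep F₁ (Ψ.inverse.map φ) :=
  FrdI.isPreStep_map_of_quasiIsotropic_of_isOfFSMFFType hF₂ hF₁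
    hT.standard.2.quasiIsotropic hT.standard.1.quasiIsotropic hT.standard.1.fsmff Ψ.symm hφ

/-- **[FrdI] Theorem 4.2 (i), primary steps, `Φ_i` WEAKLY perf-factorial, NO pre-step or base binder**: under the
typed `Thm42Setting`, `Ψ` preserves primary pre-steps (seat abc-iut-L1-t12's
`isPrimaryPreStep_map_of_preservesPreSteps_weak` fed with `isPreStep_map_of_thm42Setting`) — the binder `hprim` of
the cell's [EtTh] Cor. 3.8 (iii) weak discharge, with no FSM-type / perfectness hypothesis.
[cite: MochizukiFrdI2008, Thm. 4.2 (i) p.77] -/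
theorem isPrimaryPreStep_map_weak (hF₁ : PreFrobenioid.IsFrobenioid F₁) (hF₂ : PreFrobenioid.IsFrobenioid F₂)
    (hpf₁ : Objectwise (fun M _ => IsPerfFactorialWeak M) Φ₁)
    (hpf₂ : Objectwise (fun M _ => IsPerfFactorialWeak M) Φ₂)
    (hT : PreFrobenioidData.Thm42Setting (PreFrobenioidData.ofFunctor Φ₁ F₁) (PreFrobenioidData.ofFunctor Φ₂ F₂))
    ⦃X Y : C₁⦄ (φ : X ⟶ Y) (hφ : PreFrobenioid.IsPrimaryPreStep F₁ φ) :
    PreFrobenioid.IsPrimaryPreStep F₂ (Ψ.functor.map φ) :=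
  isPrimaryPreStep_map_of_preservesPreSteps_weak Ψ hF₁ hF₂ hpf₁ hpf₂ (isPreStep_map_of_thm42Setting Ψ hF₁ hF₂ hT)
    (isPreStep_inverse_map_of_thm42Setting Ψ hF₁ hF₂ hT) hT φ hφ

/-- … and `Ψ⁻¹` preserves primary pre-steps (the binder `hprim'`), same generality.
[cite: MochizukiFrdI2008, Thm. 4.2 (i) p.77] -/
theorem isPrimaryPreStep_inverse_map_weak (hF₁ : PreFrobenioid.IsFrobenioid F₁)
    (hF₂ : PreFrobenioid.IsFrobenioid F₂)
    (hpf₁ : Objectwise (fun M _ => IsPerfFactorialWeak M) Φ₁)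
    (hpf₂ : Objectwise (fun M _ => IsPerfFactorialWeak M) Φ₂)
    (hT : PreFrobenioidData.Thm42Setting (PreFrobenioidData.ofFunctor Φ₁ F₁) (PreFrobenioidData.ofFunctor Φ₂ F₂))
    ⦃X Y : C₂⦄ (φ : X ⟶ Y) (hφ : PreFrobenioid.IsPrimaryPreStep F₂ φ) :
    PreFrobenioid.IsPrimaryPreStep F₁ (Ψ.inverse.map φ) :=
  isPrimaryPreStep_inverse_map_of_preservesPreSteps_weak Ψ hF₁ hF₂ hpf₁ hpf₂
    (isPreStep_map_of_thm42Setting Ψ hF₁ hF₂ hT) (isPreStep_inverse_map_of_thm42Setting Ψ hF₁ hF₂ hT) hT φ hφ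

/-- **[FrdI] Theorem 4.2 (i) AS TYPED, for every pair of Frobenioids with WEAKLY perf-factorial divisor monoids
and every `Ψ`** (no pre-step binder, no base hypothesis beyond the typed `Thm42Setting`, whose standard type (d) is
the PRINTED 2008 FSMFF condition): seat abc-iut-L1-t12's `thm42i_ofFunctor_of_preservesPreSteps_weak` fed with
Thm. 3.4 (ii) as printed (`FrdI.isPreStep_map_of_quasiIsotropic_of_isOfFSMFFType`).  Weak-hypothesis twin of
`thm42i_ofFunctor`. [cite: MochizukiFrdI2008, Thm. 4.2 (i) p.77] -/
theorem thm42i_ofFunctor_weak (hF₁ : PreFrobenioid.IsFrobenioid F₁) (hF₂ : PreFrobenioid.IsFrobenioid F₂)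
    (hpf₁ : Objectwise (fun M _ => IsPerfFactorialWeak M) Φ₁)
    (hpf₂ : Objectwise (fun M _ => IsPerfFactorialWeak M) Φ₂) :
    (PreFrobenioidData.ofFunctor Φ₁ F₁).Thm42i (PreFrobenioidData.ofFunctor Φ₂ F₂) Ψ := fun hT =>
  thm42i_ofFunctor_of_preservesPreSteps_weak Ψ hF₁ hF₂ hpf₁ hpf₂
    (isPreStep_map_of_thm42Setting Ψ hF₁ hF₂ hT) (isPreStep_inverse_map_of_thm42Setting Ψ hF₁ hF₂ hT) hT

/-- **[FrdI] Theorem 4.2 (ii) AS TYPED**, weakly perf-factorial divisor monoids, every `Ψ`, no pre-step binder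
(seat abc-iut-L1-t12's `thm42ii_ofFunctor_of_preservesPreSteps_weak` fed with Thm. 3.4 (ii) as printed).
Weak-hypothesis twin of `thm42ii_ofFunctor`. [cite: MochizukiFrdI2008, Thm. 4.2 (ii) p.77] -/
theorem thm42ii_ofFunctor_weak (hF₁ : PreFrobenioid.IsFrobenioid F₁) (hF₂ : PreFrobenioid.IsFrobenioid F₂)
    (hpf₁ : Objectwise (fun M _ => IsPerfFactorialWeak M) Φ₁)
    (hpf₂ : Objectwise (fun M _ => IsPerfFactorialWeak M) Φ₂) :
    (PreFrobenioidData.ofFunctor Φ₁ F₁).Thm42ii (PreFrobenioidData.ofFunctor Φ₂ F₂) Ψ := fun hT =>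
  thm42ii_ofFunctor_of_preservesPreSteps_weak Ψ hF₁ hF₂ hpf₁ hpf₂
    (isPreStep_map_of_thm42Setting Ψ hF₁ hF₂ hT) (isPreStep_inverse_map_of_thm42Setting Ψ hF₁ hF₂ hT) hT

/-- **[FrdI] Theorem 4.2 (iii) AS TYPED** (for every candidate prime bijection `e` compatible with `Ψ` on
co-angular pre-steps, as in the typed statement), weakly perf-factorial divisor monoids, every `Ψ`, no pre-step
binder (seat abc-iut-L1-t12's `thm42iii_ofFunctor_of_preservesPreSteps_weak` fed with Thm. 3.4 (ii) as printed).
Weak-hypothesis twin of `thm42iii_ofFunctor`. [cite: MochizukiFrdI2008, Thm. 4.2 (iii) p.78] -/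
theorem thm42iii_ofFunctor_weak (hF₁ : PreFrobenioid.IsFrobenioid F₁) (hF₂ : PreFrobenioid.IsFrobenioid F₂)
    (hpf₁ : Objectwise (fun M _ => IsPerfFactorialWeak M) Φ₁)
    (hpf₂ : Objectwise (fun M _ => IsPerfFactorialWeak M) Φ₂)
    (e : ∀ A : C₁, Primes (Φ₁.obj (op (PreFrobenioid.baseObj F₁ A))) ≃
      Primes (Φ₂.obj (op (PreFrobenioid.baseObj F₂ (Ψ.functor.obj A)))))
    (he : ∀ (A : C₁) (𝔭 : Primes (Φ₁.obj (op (PreFrobenioid.baseObj F₁ A)))),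
      (∀ ⦃B : C₁⦄ (φ : A ⟶ B), PreFrobenioid.IsCoAngularPreStep F₁ φ →
          (PreFrobenioid.Div F₁ φ ∈ 𝔭.submonoid ↔
            PreFrobenioid.Div F₂ (Ψ.functor.map φ) ∈ (e A 𝔭).submonoid)) ∧
        ∀ ⦃B : C₁⦄ (ψ : B ⟶ A), PreFrobenioid.IsCoAngularPreStep F₁ ψ →
          ((∃ y ∈ 𝔭.submonoid, Frobenioids.pull Φ₁ (PreFrobenioid.Base F₁ ψ) y = PreFrobenioid.Div F₁ ψ) ↔
            ∃ y ∈ (e A 𝔭).submonoid, Frobenioids.pull Φ₂ (PreFrobenioid.Base F₂ (Ψ.functor.map ψ)) y =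
              PreFrobenioid.Div F₂ (Ψ.functor.map ψ))) :
    (PreFrobenioidData.ofFunctor Φ₁ F₁).Thm42iii (PreFrobenioidData.ofFunctor Φ₂ F₂) Ψ e := fun hT =>
  thm42iii_ofFunctor_of_preservesPreSteps_weak Ψ hF₁ hF₂ hpf₁ hpf₂
    (isPreStep_map_of_thm42Setting Ψ hF₁ hF₂ hT) (isPreStep_inverse_map_of_thm42Setting Ψ hF₁ hF₂ hT) e he hT

/-- **[FrdI] Theorem 4.2 (ii) and (iii) together**, weakly perf-factorial divisor monoids, every `Ψ`, no pre-step
binder: THE family of prime bijections of (ii) exists (clauses (a), (b)) and (iii) holds for it (seat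
abc-iut-L1-t12's `thm42ii_iii_ofFunctor_of_preservesPreSteps_weak` fed with Thm. 3.4 (ii) as printed).
[cite: MochizukiFrdI2008, Thm. 4.2 (iii) p.78] -/
theorem thm42ii_iii_ofFunctor_weak (hF₁ : PreFrobenioid.IsFrobenioid F₁) (hF₂ : PreFrobenioid.IsFrobenioid F₂)
    (hpf₁ : Objectwise (fun M _ => IsPerfFactorialWeak M) Φ₁)
    (hpf₂ : Objectwise (fun M _ => IsPerfFactorialWeak M) Φ₂)
    (hT : PreFrobenioidData.Thm42Setting (PreFrobenioidData.ofFunctor Φ₁ F₁) (PreFrobenioidData.ofFunctor Φ₂ F₂)) :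
    ∃ e : ∀ A : C₁, Primes (Φ₁.obj (op (PreFrobenioid.baseObj F₁ A))) ≃
        Primes (Φ₂.obj (op (PreFrobenioid.baseObj F₂ (Ψ.functor.obj A)))),
      (∀ (A : C₁) (𝔭 : Primes (Φ₁.obj (op (PreFrobenioid.baseObj F₁ A)))),
        (∀ ⦃B : C₁⦄ (φ : A ⟶ B), PreFrobenioid.IsCoAngularPreStep F₁ φ →
            (PreFrobenioid.Div F₁ φ ∈ 𝔭.submonoid ↔
              PreFrobenioid.Div F₂ (Ψ.functor.map φ) ∈ (e A 𝔭).submonoid)) ∧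
          ∀ ⦃B : C₁⦄ (ψ : B ⟶ A), PreFrobenioid.IsCoAngularPreStep F₁ ψ →
            ((∃ y ∈ 𝔭.submonoid, Frobenioids.pull Φ₁ (PreFrobenioid.Base F₁ ψ) y = PreFrobenioid.Div F₁ ψ) ↔
              ∃ y ∈ (e A 𝔭).submonoid, Frobenioids.pull Φ₂ (PreFrobenioid.Base F₂ (Ψ.functor.map ψ)) y =
                PreFrobenioid.Div F₂ (Ψ.functor.map ψ))) ∧
      (PreFrobenioidData.ofFunctor Φ₁ F₁).Thm42iii (PreFrobenioidData.ofFunctor Φ₂ F₂) Ψ e :=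
  thm42ii_iii_ofFunctor_of_preservesPreSteps_weak Ψ hF₁ hF₂ hpf₁ hpf₂
    (isPreStep_map_of_thm42Setting Ψ hF₁ hF₂ hT) (isPreStep_inverse_map_of_thm42Setting Ψ hF₁ hF₂ hT) hT

end

end FrdI.T42

end Literature.AlgebraicGeometry.Frobenioids
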